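import Summits.CriticalPhenomena.SAWScalingLimit.Theorems.ShellCrossingBound.Negative.Forcing1Domain

/-!
# `ShellCrossingBound` — negative knowledge: forcing corridors (the uniform-threshold Aizenman–Burchard hypothesis is false for the critical SAW)

Part 2: lattice bookkeeping at mesh `δ` (columns are integer intervals), reachability inside the mesh vertex graph, vertical walks, the spine and the resolution hypothesis `Good δ x₀`, connectivity of the resolved part (`reach_of_le_of_le`).

Support file for crux `stmt-CriticalPhenomena-4728` (refuter `cdisprove`; work file
`Summits/CriticalPhenomena/SAWScalingLimit/Cruxes/ShellCrossingBound/Disproof.lean`; conclusion in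
`Negative/UniformThresholdFalse.lean`). Everything proved. [folklore]
-/

noncomputable section

open Set Filter Topology Metric MeasureTheory Complex
open scoped ENNReal Real
open Literature.Probability.RandomPlanarGeometry Literature.Probability.LatticeModels

namespace Summit.CriticalPhenomena.SAWScalingLimit.Theorems.ShellCrossingBound.Negative.Forcing

/-! ## B.1 Lattice bookkeeping -/

/-- Mesh point of a lattice site in coordinates. [folklore] -/
theorem meshPoint_vec (δ : ℝ) (i j : ℤ) : meshPoint δ ![i, j] = ⟨δ * i, δ * j⟩ := by
  apply Complex.ext <;> simp

/-- One lattice step to the right. [folklore] -/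
theorem vec_add_single_zero (i j : ℤ) : (![i, j] : Site 2) + Pi.single 0 1 = ![i + 1, j] := by
  funext k; fin_cases k <;> simp

/-- One lattice step up. [folklore] -/
theorem vec_add_single_one (i j : ℤ) : (![i, j] : Site 2) + Pi.single 1 1 = ![i, j + 1] := by
  funext k; fin_cases k <;> simp

/-- A site of `ℤ²` in coordinates. [folklore] -/
theorem eq_vec (v : Site 2) : v = ![v 0, v 1] := by
  funext k; fin_cases k <;> simp

/-- Membership of a lattice site in the mesh vertices of the witness domain. [folklore] -/
theorem vec_mem_iff (δ : ℝ) (i j : ℤ) :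
    (![i, j] : Site 2) ∈ meshVertices forcingDomain.carrier δ ↔
      |δ * j - ctr (δ * i)| < sl * (δ * i) ∧ δ * i < 1 := by
  rw [mem_meshVertices_iff, carrier_eq_SW, meshPoint_vec]
  rfl

/-- Mesh vertices of the witness domain have positive abscissa. [folklore] -/
theorem re_pos_of_mem {δ : ℝ} {i j : ℤ} (h : (![i, j] : Site 2) ∈ meshVertices forcingDomain.carrier δ) :
    0 < δ * i := by
  rw [vec_mem_iff] at h
  have := abs_nonneg (δ * j - ctr (δ * i))
  nlinarith [sl_pos, h.1]

/-- A segment whose points all lie in the open sheared wedge lies in the closure of the carrier. [folklore] -/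
theorem segment_subset_closure {p q : ℂ} (h : ∀ θ ∈ Icc (0 : ℝ) 1, p + θ • (q - p) ∈ SW) :
    segment ℝ p q ⊆ closure forcingDomain.carrier := by
  rw [segment_eq_image']
  rintro _ ⟨θ, hθ, rfl⟩
  exact subset_closure (SW_subset_carrier (h θ hθ))

/-- Horizontal mesh edge `(i, j) — (i + 1, j)`. [folklore] -/
theorem meshGraph_adj_horizontal {δ : ℝ} (hδ : 0 < δ) {i j : ℤ}
    (h : ∀ x ∈ Icc (δ * i) (δ * i + δ), |δ * j - ctr x| < sl * x) (h1 : δ * i + δ < 1) :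
    (meshGraph forcingDomain.carrier δ).Adj ![i, j] ![i + 1, j] := by
  rw [meshGraph_adj_iff]
  refine ⟨(zdGraph_adj_iff _ _).2 ⟨0, Or.inl (vec_add_single_zero i j).symm⟩, ?_⟩
  rw [meshPoint_vec, meshPoint_vec]
  apply segment_subset_closure
  intro θ hθ
  have hsub : (⟨δ * ↑(i + 1), δ * j⟩ : ℂ) - ⟨δ * i, δ * j⟩ = ⟨δ, 0⟩ := by
    apply Complex.ext
    · simp; ring
    · simp
  rw [hsub, smul_mk]
  have hx : δ * i + θ * δ ∈ Icc (δ * i) (δ * i + δ) :=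
    ⟨by nlinarith [hθ.1], by nlinarith [hθ.2]⟩
  refine ⟨?_, ?_⟩
  · simpa using h _ hx
  · simp only [add_re, mul_zero]
    linarith [hx.2]

/-- Vertical mesh edge `(i, j) — (i, j + 1)`. [folklore] -/
theorem meshGraph_adj_vertical {δ : ℝ} (hδ : 0 < δ) {i j : ℤ}
    (h : ∀ y ∈ Icc (δ * j) (δ * j + δ), |y - ctr (δ * i)| < sl * (δ * i)) (h1 : δ * i < 1) :
    (meshGraph forcingDomain.carrier δ).Adj ![i, j] ![i, j + 1] := by
  rw [meshGraph_adj_iff]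
  refine ⟨(zdGraph_adj_iff _ _).2 ⟨1, Or.inl (vec_add_single_one i j).symm⟩, ?_⟩
  rw [meshPoint_vec, meshPoint_vec]
  apply segment_subset_closure
  intro θ hθ
  have hsub : (⟨δ * i, δ * ↑(j + 1)⟩ : ℂ) - ⟨δ * i, δ * j⟩ = ⟨0, δ⟩ := by
    apply Complex.ext
    · simp
    · simp; ring
  rw [hsub, smul_mk]
  have hy : δ * j + θ * δ ∈ Icc (δ * j) (δ * j + δ) :=
    ⟨by nlinarith [hθ.1], by nlinarith [hθ.2]⟩
  refine ⟨?_, ?_⟩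
  · simpa using h _ hy
  · simpa using h1

/-! ## B.2 Reachability inside the mesh vertex graph -/

/-- Reachability of two lattice sites inside the mesh vertex graph of the witness domain. [folklore] -/
def Reach (δ : ℝ) (u v : Site 2) : Prop :=
  ∃ (hu : u ∈ meshVertices forcingDomain.carrier δ) (hv : v ∈ meshVertices forcingDomain.carrier δ),
    (meshVertexGraph forcingDomain.carrier δ).Reachable ⟨u, hu⟩ ⟨v, hv⟩

/-- The first site of a reachable pair is a mesh vertex. [folklore] -/
theorem Reach.fst {δ : ℝ} {u v : Site 2} (h : Reach δ u v) : u ∈ meshVertices forcingDomain.carrier δ :=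
  h.1

/-- The second site of a reachable pair is a mesh vertex. [folklore] -/
theorem Reach.snd {δ : ℝ} {u v : Site 2} (h : Reach δ u v) : v ∈ meshVertices forcingDomain.carrier δ :=
  h.2.1

/-- Reflexivity of reachability at a mesh vertex. [folklore] -/
theorem Reach.rfl' {δ : ℝ} {u : Site 2} (hu : u ∈ meshVertices forcingDomain.carrier δ) : Reach δ u u :=
  ⟨hu, hu, SimpleGraph.Reachable.refl _⟩

/-- Symmetry of reachability. [folklore] -/
theorem Reach.symm {δ : ℝ} {u v : Site 2} (h : Reach δ u v) : Reach δ v u := by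
  obtain ⟨hu, hv, h⟩ := h
  exact ⟨hv, hu, h.symm⟩

/-- Transitivity of reachability. [folklore] -/
theorem Reach.trans {δ : ℝ} {u v w : Site 2} (h₁ : Reach δ u v) (h₂ : Reach δ v w) : Reach δ u w := by
  obtain ⟨hu, hv, h₁⟩ := h₁
  obtain ⟨hv', hw, h₂⟩ := h₂
  exact ⟨hu, hw, h₁.trans h₂⟩

/-- Adjacent mesh vertices are reachable from each other. [folklore] -/
theorem reach_of_adj {δ : ℝ} {u v : Site 2} (h : (meshGraph forcingDomain.carrier δ).Adj u v)
    (hu : u ∈ meshVertices forcingDomain.carrier δ) (hv : v ∈ meshVertices forcingDomain.carrier δ) :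
    Reach δ u v := by
  refine ⟨hu, hv, SimpleGraph.Adj.reachable ?_⟩
  simp only [SimpleGraph.comap_adj, Function.Embedding.subtype_apply]
  exact h

/-! ## B.3 Vertical walks inside a column -/

/-- In column `i` (`0 < δ i < 1`), two levels `j₁ ≤ j₂` all of whose intermediate lattice points
lie strictly inside the wedge are joined inside the mesh vertex graph. [folklore] -/
theorem reach_vertical {δ : ℝ} (hδ : 0 < δ) {i : ℤ} (h1 : δ * i < 1) (j₁ : ℤ) (n : ℕ)
    (h : ∀ j : ℤ, j₁ ≤ j → j ≤ j₁ + n → |δ * j - ctr (δ * i)| < sl * (δ * i)) :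
    Reach δ ![i, j₁] ![i, j₁ + n] := by
  induction n with
  | zero =>
    simp only [Nat.cast_zero, add_zero]
    exact Reach.rfl' ((vec_mem_iff δ i j₁).2 ⟨h j₁ le_rfl (by simp), h1⟩)
  | succ n ih =>
    have ih' := ih fun j hj hj' => h j hj (by push_cast; linarith)
    have hmemn : (![i, j₁ + n] : Site 2) ∈ meshVertices forcingDomain.carrier δ := ih'.snd
    have hlast : |δ * ↑(j₁ + (n + 1 : ℕ)) - ctr (δ * i)| < sl * (δ * i) := h _ (by push_cast; linarith) le_rfl
    have hmem1 : (![i, j₁ + (n + 1 : ℕ)] : Site 2) ∈ meshVertices forcingDomain.carrier δ :=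
      (vec_mem_iff δ i _).2 ⟨hlast, h1⟩
    refine ih'.trans (reach_of_adj ?_ hmemn hmem1)
    have hcast : (j₁ + ((n + 1 : ℕ) : ℤ)) = (j₁ + n) + 1 := by push_cast; ring
    rw [hcast]
    apply meshGraph_adj_vertical hδ _ h1
    intro y hy
    -- `y` lies between two lattice levels both strictly inside the wedge
    have ha : |δ * ↑(j₁ + ↑n) - ctr (δ * i)| < sl * (δ * i) := by
      have := (vec_mem_iff δ i _).1 hmemn; exact this.1
    have hb : |δ * (↑(j₁ + ↑n) + 1) - ctr (δ * i)| < sl * (δ * i) := by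
      have : (↑(j₁ + ((n + 1 : ℕ) : ℤ)) : ℝ) = ↑(j₁ + (n : ℤ)) + 1 := by push_cast; ring
      rw [this] at hlast; exact hlast
    rw [abs_lt] at ha hb ⊢
    obtain ⟨hy1, hy2⟩ := hy
    constructor <;> nlinarith

/-- Symmetric packaging: levels `j` and `j'` in column `i` with all levels between them strictly
inside the wedge are joined. [folklore] -/
theorem reach_column {δ : ℝ} (hδ : 0 < δ) {i : ℤ} (h1 : δ * i < 1) (j j' : ℤ)
    (h : ∀ k : ℤ, min j j' ≤ k → k ≤ max j j' → |δ * k - ctr (δ * i)| < sl * (δ * i)) :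
    Reach δ ![i, j] ![i, j'] := by
  rcases le_total j j' with hjj | hjj
  · obtain ⟨n, rfl⟩ := Int.le.dest hjj
    exact reach_vertical hδ h1 j n fun k hk hk' => h k (by simp [hk]) (by simp [hk'])
  · obtain ⟨n, rfl⟩ := Int.le.dest hjj
    exact (reach_vertical hδ h1 j' n fun k hk hk' =>
      h k (by simp [hk]) (by simp [hk'])).symm


/-! ## C.1 The spine and the resolution hypothesis -/

/-- Spine level in column `i`: the lattice level nearest to the centre line. [folklore] -/
def jsp (δ : ℝ) (i : ℤ) : ℤ := round (ctr (δ * i) / δ)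

/-- The spine level is within half a mesh of the centre line. [folklore] -/
theorem abs_jsp {δ : ℝ} (hδ : 0 < δ) (i : ℤ) : |δ * (jsp δ i : ℝ) - ctr (δ * i)| ≤ δ / 2 := by
  have h := abs_sub_round (ctr (δ * i) / δ)
  have : δ * (jsp δ i : ℝ) - ctr (δ * i) = -(δ * (ctr (δ * i) / δ - round (ctr (δ * i) / δ))) := by
    rw [jsp]; field_simp; ring
  rw [this, abs_neg, abs_mul, abs_of_pos hδ]
  nlinarith

/-- The mesh `δ` RESOLVES the witness domain to the right of `x₀`: the mesh is small against the
wedge width at `x₀` and the centre line varies by at most a quarter of that width over one mesh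
step on `[x₀, 1]`. [folklore] -/
structure Good (δ x₀ : ℝ) : Prop where
  hδ : 0 < δ
  hx₀ : 0 < x₀
  hx₁ : x₀ ≤ 1 / 4
  hsmall : 8 * δ ≤ sl * x₀
  hmod : ∀ x x', x₀ ≤ x → x ≤ x' → x' ≤ x + δ → x' ≤ 1 → |ctr x' - ctr x| ≤ sl * x₀ / 4

/-- Between two lattice levels the distance to a fixed number is controlled by the endpoints. [folklore] -/
theorem abs_sub_le_max_of_mem {δ c : ℝ} (hδ : 0 ≤ δ) {a b k : ℤ} (ha : min a b ≤ k) (hb : k ≤ max a b) :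
    |δ * k - c| ≤ max |δ * a - c| |δ * b - c| := by
  rw [abs_le]
  have h1 : δ * (min a b : ℤ) ≤ δ * k := mul_le_mul_of_nonneg_left (Int.cast_le.2 ha) hδ
  have h2 : δ * k ≤ δ * (max a b : ℤ) := mul_le_mul_of_nonneg_left (Int.cast_le.2 hb) hδ
  constructor
  · rcases le_total a b with hab | hab
    · rw [min_eq_left hab] at h1
      linarith [neg_abs_le (δ * a - c), le_max_left |δ * a - c| |δ * b - c|]
    · rw [min_eq_right hab] at h1
      linarith [neg_abs_le (δ * b - c), le_max_right |δ * a - c| |δ * b - c|]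
  · rcases le_total a b with hab | hab
    · rw [max_eq_right hab] at h2
      linarith [le_abs_self (δ * b - c), le_max_right |δ * a - c| |δ * b - c|]
    · rw [max_eq_left hab] at h2
      linarith [le_abs_self (δ * a - c), le_max_left |δ * a - c| |δ * b - c|]

section Spine

variable {δ x₀ : ℝ} (hg : Good δ x₀)
include hg

/-- The spine level of column `i ≥ x₀/δ` is well inside the wedge, also seen from column `i + 1`. [folklore] -/
theorem abs_jsp_next {i : ℤ} (hi : x₀ ≤ δ * i) (hi1 : δ * i + δ ≤ 1) {x : ℝ} (hx : δ * i ≤ x)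
    (hx' : x ≤ δ * i + δ) : |δ * (jsp δ i : ℝ) - ctr x| < sl * x₀ / 2 + sl * x₀ / 4 := by
  have h1 := abs_jsp hg.hδ i
  have h2 := hg.hmod (δ * i) x hi hx hx' (hx'.trans hi1)
  have h3 : δ / 2 < sl * x₀ / 2 := by linarith [hg.hsmall, hg.hδ]
  calc |δ * (jsp δ i : ℝ) - ctr x| ≤ |δ * (jsp δ i : ℝ) - ctr (δ * i)| + |ctr (δ * i) - ctr x| :=
        abs_sub_le _ _ _
    _ < sl * x₀ / 2 + sl * x₀ / 4 := by
        rw [abs_sub_comm (ctr (δ * i)) (ctr x)]; linarith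

/-- Spine points of resolved columns are mesh vertices. [folklore] -/
theorem spine_mem {i : ℤ} (hi : x₀ ≤ δ * i) (hi1 : δ * i < 1) :
    (![i, jsp δ i] : Site 2) ∈ meshVertices forcingDomain.carrier δ := by
  rw [vec_mem_iff]
  refine ⟨?_, hi1⟩
  have h1 := abs_jsp hg.hδ i
  have : δ / 2 < sl * (δ * i) := by nlinarith [hg.hsmall, hg.hδ, sl_pos]
  linarith

/-- One step along the spine. [folklore] -/
theorem reach_spine_step {i : ℤ} (hi : x₀ ≤ δ * i) (hi1 : δ * i + δ < 1) :
    Reach δ ![i, jsp δ i] ![i + 1, jsp δ (i + 1)] := by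
  have hδ := hg.hδ
  have hs := sl_pos
  have hcast : (δ * ↑(i + 1) : ℝ) = δ * i + δ := by push_cast; ring
  have hi' : x₀ ≤ δ * ↑(i + 1) := by rw [hcast]; linarith
  have hi1' : δ * ↑(i + 1) < 1 := by rw [hcast]; exact hi1
  -- horizontal edge
  have hA : Reach δ ![i, jsp δ i] ![i + 1, jsp δ i] := by
    have hmem0 := spine_mem hg hi (by linarith)
    have hbnd : ∀ x ∈ Icc (δ * i) (δ * i + δ), |δ * (jsp δ i : ℝ) - ctr x| < sl * x := by
      intro x hx
      have := abs_jsp_next hg hi hi1.le hx.1 hx.2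
      have hx0 : x₀ ≤ x := hi.trans hx.1
      have h1 := mul_le_mul_of_nonneg_left hx0 hs.le
      have h2 := mul_pos hs hg.hx₀
      linarith
    have hmem1 : (![i + 1, jsp δ i] : Site 2) ∈ meshVertices forcingDomain.carrier δ := by
      rw [vec_mem_iff, hcast]
      exact ⟨hbnd _ ⟨by linarith, le_rfl⟩, hi1⟩
    exact reach_of_adj (meshGraph_adj_horizontal hδ hbnd hi1) hmem0 hmem1
  -- vertical piece in column `i + 1`
  have hB : Reach δ ![i + 1, jsp δ i] ![i + 1, jsp δ (i + 1)] := by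
    apply reach_column hδ hi1'
    intro k hk hk'
    have hle := abs_sub_le_max_of_mem (c := ctr (δ * ↑(i + 1))) hδ.le hk hk'
    have ha : |δ * (jsp δ i : ℝ) - ctr (δ * ↑(i + 1))| < sl * x₀ / 2 + sl * x₀ / 4 :=
      abs_jsp_next hg hi hi1.le (by rw [hcast]; linarith) (by rw [hcast])
    have hb : |δ * (jsp δ (i + 1) : ℝ) - ctr (δ * ↑(i + 1))| ≤ δ / 2 := abs_jsp hδ (i + 1)
    have hmax : max |δ * (jsp δ i : ℝ) - ctr (δ * ↑(i + 1))| |δ * (jsp δ (i + 1) : ℝ) - ctr (δ * ↑(i + 1))|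
        < sl * x₀ := by
      rw [max_lt_iff]; constructor <;> nlinarith [hg.hsmall]
    have hx : sl * x₀ ≤ sl * (δ * ↑(i + 1)) := mul_le_mul_of_nonneg_left hi' hs.le
    linarith
  exact hA.trans hB

/-- Along the spine from column `i` to column `i + n`. [folklore] -/
theorem reach_spine (i : ℤ) (n : ℕ) (hi : x₀ ≤ δ * i) (hin : δ * (i + n) < 1) :
    Reach δ ![i, jsp δ i] ![i + n, jsp δ (i + n)] := by
  induction n with
  | zero => simpa using Reach.rfl' (spine_mem hg hi (by simpa using hin))
  | succ n ih =>
    have hδ := hg.hδ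
    have hin' : δ * (i + n) < 1 := by push_cast at hin ⊢; nlinarith
    have h1 := ih hin'
    have h2 := reach_spine_step hg (i := i + n) (by push_cast; nlinarith) (by push_cast at hin ⊢; linarith)
    have hcast : (i + (n : ℤ) + 1 : ℤ) = i + ((n + 1 : ℕ) : ℤ) := by push_cast; ring
    rw [hcast] at h2
    exact h1.trans h2

/-- Every mesh vertex of a resolved column is joined to the spine point of its column. [folklore] -/
theorem reach_to_spine {i j : ℤ} (hmem : (![i, j] : Site 2) ∈ meshVertices forcingDomain.carrier δ)
    (hi : x₀ ≤ δ * i) : Reach δ ![i, j] ![i, jsp δ i] := by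
  have hδ := hg.hδ
  obtain ⟨hj, hi1⟩ := (vec_mem_iff δ i j).1 hmem
  apply reach_column hδ hi1
  intro k hk hk'
  have hle := abs_sub_le_max_of_mem (c := ctr (δ * i)) hδ.le hk hk'
  have hb : |δ * (jsp δ i : ℝ) - ctr (δ * i)| < sl * (δ * i) := by
    have := abs_jsp hδ i
    nlinarith [hg.hsmall, sl_pos]
  exact hle.trans_lt (max_lt hj hb)

/-- **The resolved part is connected**: any two mesh vertices to the right of `x₀` are joined in
the mesh vertex graph. [folklore] -/
theorem reach_of_le_of_le {u v : Site 2} (hu : u ∈ meshVertices forcingDomain.carrier δ)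
    (hv : v ∈ meshVertices forcingDomain.carrier δ) (hxu : x₀ ≤ δ * u 0) (hxv : x₀ ≤ δ * v 0) :
    Reach δ u v := by
  -- reduce to `u 0 ≤ v 0`
  suffices key : ∀ u v : Site 2, u ∈ meshVertices forcingDomain.carrier δ →
      v ∈ meshVertices forcingDomain.carrier δ → x₀ ≤ δ * u 0 → x₀ ≤ δ * v 0 → u 0 ≤ v 0 →
      Reach δ u v by
    rcases le_total (u 0) (v 0) with h | h
    · exact key u v hu hv hxu hxv h
    · exact (key v u hv hu hxv hxu h).symm
  intro u v hu hv hxu hxv huv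
  rw [eq_vec u] at hu ⊢
  rw [eq_vec v] at hv ⊢
  obtain ⟨n, hn⟩ := Int.le.dest huv
  have hv1 : δ * v 0 < 1 := ((vec_mem_iff δ (v 0) (v 1)).1 hv).2
  have h1 := reach_to_spine hg hu hxu
  have h2 := reach_to_spine hg hv hxv
  have h3 := reach_spine hg (u 0) n hxu (by rw [← Int.cast_natCast, ← Int.cast_add, hn]; exact hv1)
  rw [hn] at h3
  exact h1.trans (h3.trans h2.symm)

end Spine

end Summit.CriticalPhenomena.SAWScalingLimit.Theorems.ShellCrossingBound.Negative.Forcing
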